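import Literature.MathematicalPhysics.QuantumFieldTheory.Balaban1983to89.B9Eq349ConjugatedQTowerLetters
import Literature.MathematicalPhysics.QuantumFieldTheory.Balaban1983to89.B9Eq349ConjugatedQLettersTwoBackgrounds

/-!
# `Balaban1983to89.B9Eq349ConjugatedQTowerLettersTwoBackgrounds` — T. Bałaban, *Propagators for lattice gauge theories in a background field*, Commun.
# Math. Phys. **99** (1985) 389–434 [Balaban1985BackgroundPropagators] (3.15)–(3.16) p. 393, (3.49) p. 399, (3.78)–(3.79) p. 406, (3.83) p. 407,
# (3.101)–(3.103) p. 414, with [Balaban1985Averaging] Proposition 7 p. 43, (124)–(127) pp. 36–37: **THE COMBES–THOMAS LETTER OF THE TWO-FAMILY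
# DIFFERENCE `Q_k(U) − Q_k(V)` OF THE COMPOSITE VECTOR AVERAGING IN `ℓ²`, TELESCOPED THREE-WAY (conjugation × two families × levels)** — with the
# per-level cut-offs `χ_j` and two-block readings `ℓ′_j` of the one-family letter `B9Eq349ConjugatedQTowerLetters` DISPLAYED verbatim:
# `√Σ_c‖e^{κχ_0(c₋)}•((Q_n(U) − Q_n(V))(e^{−κχ_n}•A))(c)‖² ≤ P′_n·(T̃_n − 1)·(√(L^{−d}))^n·√Σ_b‖A b‖²`,
# `P′_n = Π_{j<n}(1 + √(L^d)(θ_j + e_j))`, `θ_j = √(2d)·102(d+1)²Lε_j`, `e_j = 2‖κ‖ℓ′_j·√(2(2d(102(d+1)²Lε_j)² + L^{−d}))`,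
# `T̃_n = Π_{j<n}(1 + √(L^d)β_j)`, `β_j = (1 + 2‖κ‖ℓ′_j)·2d·75497472(d+1)N·δ_j` (`N = (2d+2)L`)

statement-level skeleton of published theorems with citation tags; proofs where landed; nothing here is a claim about the Yang–Mills mass gap

PDF held: `paper:balaban1985-cmp99-background-propagators` (journal page = PDF page + 388): p. 393 (3.15)–(3.16), p. 399 (3.49), p. 407 (3.83) («with the norm
|A′| restricted to the blocks»), p. 414 (3.101)–(3.103) — re-read for this file through the held text and the verbatim quotations of the two suppliers.

CITATION HEADER (lean-in-tree rule 2026-08-18).  Audit cell `pub-balaban`, sub-cell `t4`, NE9 crux team (2): LEAF PROVER 01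
(`b2b-balaban-t4-ne9-formalise-leaf-01` gen 90), file 2 of the batch «the `δ_Q` ∕ `δ_Q′` conjuncts of the N52 road (α) END».  WHY: after this
lineage's I-13 `B9Eq326DeltaABlockDecayTowerTwoBackgroundsCurv` (gen 88) the big-block `L²` decay constant of `G₁,k(V) − G₁,k(U)` still DISPLAYS (its
`hT2'`) the CONJUGATED two-background letters `δ_R` (non-local `R_k`) and `δ_Q` ∕ `δ_Q′` — `‖S_F((Q_k(V) − Q_k(U))(S⁻¹f))‖ ≤ δ_Q‖f‖` and the adjoint
twin, with `δ_Q` proportional to the closeness of the two backgrounds (the END is a Lipschitz reading; the cheap split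
`S_F(Q_V − Q_U)S⁻¹ = [S_FQ_VS⁻¹ − Q_V] − [S_FQ_US⁻¹ − Q_U] + [Q_V − Q_U]` is `O(‖κ‖ℓ′)`, not `O(δ)`, hence useless).  This file is the raw `ℓ²`
tower letter with per-level cut-offs (file 2 of the batch); the reading on the chain's carriers and the companion shape (ONE physical cut-off pair, the
operator exponentials `exp(κ•M)`) are the siblings `…TwoBackgroundsReadings` ∕ `…TwoBackgroundsCompanion`.  TEMPLATES CREDITED: the NE9 OWNER lineage `b2b-balaban-t4-ne9-p1` gen 93
(`B9Eq349ConjugatedQTowerLetters`: the frame, the one-family brick `sqrt_sum_norm_sq_QtorusLin_conj_le`, the telescoped one-family letter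
`sqrt_sum_norm_sq_Qtower_conj_sub_le`) and ne9-leaf-04 gen 77 (`B9Eq315QTowerLipschitzL2TwoBackgrounds`: the two-family recursion `D_{n+1} ≤ D_n(1+Θ_n) +
P_nΘ₂,ₙ`, `D_n ≤ P_n(T_n − 1)`, the one-family size `sqrt_sum_norm_sq_Qtower_le`); the brick is this lineage's sibling `B9Eq349ConjugatedQLettersTwoBackgrounds`.  Print never conjugates `Q_k(U)`; the telescoping with intermediate
weights is the ROUTE's device and every constant below is the cell's.

WHAT IS PROVED (sorry-free; proof lane — no `def`; [folklore] finite sums + Minkowski + Hilbert-space plumbing; nothing of [B9]∕[B7] asserted).  Data as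
`B9Eq315QTowerLipschitzL2TwoBackgrounds` §2 (`m`, `hL`, height `k`, two backgrounds `U`, `V` on `T_{L^k m}` with per-level letters `α_j` ∕ `α′_j ≤ 1∕128`,
COMMON bond smallness `ε_j`, multiplicative closeness `‖Ū^j(b)V̄^j(b)⁻¹ − 1‖ ≤ δ_j ≤ 1∕(12288N)`) plus gen 93's per-level cut-offs `χ_j`, readings `ℓ′_j`
(`|χ_j(c₋) − χ_{j+1}(b₋)| ≤ ℓ′_j` for `b₋ ∈ B(c₋) ∪ B(c₊)`, `j < k`) and windows `‖κ‖ℓ′_j ≤ 1`.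
* §0 Minkowski in `ℓ²` (private, as in the suppliers).  The ONE-STEP BRICK `Σ_c‖(Q(U)(w_c•A))(c) − (Q(V)(w_c•A))(c)‖² ≤ ((1 + 2‖κ‖ℓ′)·2d·75497472(d+1)N·δ)²·
  Σ_b‖A b‖²` (`w_c(b) = e^{κχ′(c₋)}e^{−κχ(b₋)}`; truncation to `B(c₋) ∪ B(c₊)` + the whole `ℓ²` sum of the one-step two-background letter + multiplicity `2d`)
  is the sibling `B9Eq349ConjugatedQLettersTwoBackgrounds.sum_norm_sq_QtorusLin_sub_QtorusLin_conj_le` BY NAME.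
* §1 (the tower) `sqrt_sum_norm_sq_QtorusLin_sub_QtorusLin_conj_le` (the brick at level `j` in `√` form), **`sqrt_sum_norm_sq_Qtower_conj_le`** (the conjugated
  ONE-family size `√Σ_c‖e^{κχ_0}•(Q_n(V)(e^{−κχ_n}•A))(c)‖² ≤ P′_n·ρ^n·√Σ‖A‖²` — gen 93 §2 plus leaf-04 §1, Minkowski),
  **`sqrt_sum_norm_sq_Qtower_conj_sub_Qtower_conj_le`** — THE TELESCOPED TWO-FAMILY LETTER displayed in the title: induction over
  `Q_{n+1} = Q_n∘Q(·̄^n)` with the intermediate weight `e^{∓κχ_n}`: `C^U_{n+1}A − C^V_{n+1}A = (C^U_n − C^V_n)(x′_U) + C^V_n(x′_U − x′_V)`,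
  `x′_• = e^{κχ_n}•Q(·̄^n)(e^{−κχ_{n+1}}•A)`, `‖x′_U‖ ≤ (ρ + θ_n + e_n)‖A‖` (flat + deviation + gen 93's brick), `‖x′_U − x′_V‖ ≤ β_n‖A‖` (the brick),
  `‖C^V_n‖ ≤ P′_nρ^n`; the recursion `D̃_{n+1} ≤ D̃_n(1 + √(L^d)(θ_n + e_n)) + P′_n√(L^d)β_n` is closed by `D̃_n ≤ P′_n(T̃_n − 1)`.
  The reading on the chain's weighted `L²` carriers (`Q_{n+1}(·) = QkW`: the `δ_Q` ∕ `δ_Q′` letters proper, through gen 93 §3's transport and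
  `B9Eq324ConjugatedFormDifference.norm_le_of_inner_eq_inner` for the adjoint) is the sibling `B9Eq349ConjugatedQTowerLettersTwoBackgroundsReadings`.
MODEL ∕ DECLARED READINGS.  Those of the two suppliers: the tower of tori, the level averages `UlevOf` of two backgrounds of the level-`k` torus, `𝔸` a
complete normed `ℂ`-algebra with `‖1‖ = 1`; the per-depth regularity, smallness and closeness of the level averages are DISPLAYED hypotheses ([B7] Prop. 2
and the Lipschitz continuity of `U ↦ Ū` are NOT proved here); per-level cut-offs and readings DISPLAYED (their construction from one physical cut-off is
the companion's, by gen 94's `B9Eq349TowerCutoffReadings`).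
HONEST SCOPE.  [folklore] telescoping of landed one-step letters; crude constants (`(1 + 2‖κ‖ℓ′_j)·2d` where `√(2d)` enters twice); ONE displayed letter
of one route sub-step's END supplied in abstract form; nothing of [B9] Thm 3.1∕3.3∕3.4∕3.11 or [B7] Prop. 2∕7 asserted, valued or discharged; «NE9 ⇐ the
named binders»; NE9 NOT PRINTED ∕ NOT PROVED; NOT summit progress (cell pub-balaban: row NE9 WALLED ON A MODEL (O-NE9-1; #5 UNRULED); spine PROVED 0∕9;
rung (B)+1 on a finite T⁴ — NOT infinite volume, NOT mass gap, NOT BetaPertH, NOT Clay; HONEST DEPENDENCY: continuum YM on T⁴ ⇐ BetaPertH ∧ nine spine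
estimates (0/9 proved); BetaPertH ⇐ (D1) ∧ (D4) ∧ CAP+tail; G-an2-4 gates asym, D1 and NE2/3/4).  NEW file; nothing modified.  Net new unproved facts: 0.
-/

noncomputable section

open scoped InnerProductSpace ComplexConjugate BigOperators

namespace Literature.MathematicalPhysics.QuantumFieldTheory.Balaban1983to89.B9Eq349ConjugatedQTowerLettersTwoBackgrounds

open B4Sect5Torus (TSite)
open B9SectCLatticeCarrier (Bond shift)
open B7Prop1Explicit (U1 Wcx boxVec)
open B9Eq319QprimeTorus (fineP blockCoord)
open B9Eq315QTorus (perCfg cornerSite QtorusLin)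
open B9Eq315QFlatNorm (sum_norm_sq_QtorusLin_one_le)
open B9Eq315QLipschitzL2 (sum_norm_sq_QtorusLin_sub_flat_le)
open B9Eq315QTower (towerP UlevOf Qtower QkOfU)
open B9Eq326OperatorTower (QkW)
open B9Eq311L2Pairing (WL2)
open B11Eq103H1Complex (BondL2K)
open B9Eq349ConjugatedQTowerLetters (conj_QtorusLin_sub_apply sqrt_sum_norm_sq_QtorusLin_conj_le sqrt_sum_norm_sq_Qtower_conj_sub_le)
open B9Eq315QTowerLipschitzL2TwoBackgrounds (sqrt_sum_norm_sq_Qtower_le)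

open B9Eq349ConjugatedQLettersTwoBackgrounds (smul_QtorusLin_smul_apply sum_norm_sq_QtorusLin_sub_QtorusLin_conj_le)
variable {d : ℕ} (L : ℕ) [NeZero L]

/-! ## §0 Minkowski in `ℓ²` (finite families) -/

omit [NeZero L] in
/-- `√(Σ ‖x_b + y_b‖²) ≤ √(Σ ‖x_b‖²) + √(Σ ‖y_b‖²)` (Cauchy–Schwarz `Real.sum_mul_le_sqrt_mul_sqrt`). [folklore] -/
private theorem sqrt_sum_norm_add_sq_le {ι : Type*} [Fintype ι] {E : Type*} [SeminormedAddCommGroup E] (x y : ι → E) :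
    Real.sqrt (∑ b, ‖x b + y b‖ ^ 2) ≤ Real.sqrt (∑ b, ‖x b‖ ^ 2) + Real.sqrt (∑ b, ‖y b‖ ^ 2) := by
  have hX : 0 ≤ Real.sqrt (∑ b, ‖x b‖ ^ 2) := Real.sqrt_nonneg _
  have hY : 0 ≤ Real.sqrt (∑ b, ‖y b‖ ^ 2) := Real.sqrt_nonneg _
  have hcs : ∑ b, ‖x b‖ * ‖y b‖ ≤ Real.sqrt (∑ b, ‖x b‖ ^ 2) * Real.sqrt (∑ b, ‖y b‖ ^ 2) := Real.sum_mul_le_sqrt_mul_sqrt _ _ _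
  rw [Real.sqrt_le_left (by positivity)]
  calc ∑ b, ‖x b + y b‖ ^ 2 ≤ ∑ b, (‖x b‖ + ‖y b‖) ^ 2 :=
        Finset.sum_le_sum fun b _ => pow_le_pow_left₀ (norm_nonneg _) (norm_add_le _ _) 2
    _ = ∑ b, ‖x b‖ ^ 2 + 2 * ∑ b, ‖x b‖ * ‖y b‖ + ∑ b, ‖y b‖ ^ 2 := by
        rw [Finset.mul_sum, ← Finset.sum_add_distrib, ← Finset.sum_add_distrib]
        exact Finset.sum_congr rfl fun b _ => by ring
    _ ≤ ∑ b, ‖x b‖ ^ 2 + 2 * (Real.sqrt (∑ b, ‖x b‖ ^ 2) * Real.sqrt (∑ b, ‖y b‖ ^ 2)) + ∑ b, ‖y b‖ ^ 2 := by linarith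
    _ = (Real.sqrt (∑ b, ‖x b‖ ^ 2) + Real.sqrt (∑ b, ‖y b‖ ^ 2)) ^ 2 := by
        rw [add_sq, Real.sq_sqrt (Finset.sum_nonneg fun _ _ => by positivity),
          Real.sq_sqrt (Finset.sum_nonneg fun _ _ => by positivity)]; ring

omit [NeZero L] in
/-- `√(Σ ‖x_b‖²) ≤ √(Σ ‖y_b‖²) + √(Σ ‖x_b − y_b‖²)`. [folklore] -/
private theorem sqrt_sum_norm_sq_le_add_sub {ι : Type*} [Fintype ι] {E : Type*} [SeminormedAddCommGroup E] (x y : ι → E) :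
    Real.sqrt (∑ b, ‖x b‖ ^ 2) ≤ Real.sqrt (∑ b, ‖y b‖ ^ 2) + Real.sqrt (∑ b, ‖x b - y b‖ ^ 2) := by
  have h := sqrt_sum_norm_add_sq_le y (fun b => x b - y b)
  simp only [add_sub_cancel] at h
  exact h
/-! ## §1 The tower: the brick at level `j`, the conjugated one-family size, the telescoped two-family letter -/

section Tower

variable {𝔸 : Type*} [NormedRing 𝔸] [NormOneClass 𝔸] [NormedAlgebra ℂ 𝔸] [CompleteSpace 𝔸]
  (m : Fin d → ℕ) [∀ i, NeZero (m i)] (hL : 1 ≤ L) (k : ℕ) (U V : Bond d (towerP L m k) → 𝔸ˣ)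
  (α : ℕ → ℝ) (hα1 : ∀ j, α j ≤ 1 / 64)
  (hU1 : ∀ (j : ℕ) (x : B7Prop1Explicit.Site d) (κ : Fin d), perCfg (towerP L m (j + 1)) (UlevOf L m k U j) x κ ∈ U1 𝔸)
  (hreg : ∀ (j : ℕ) (y : TSite d (towerP L m j)) (κ : Fin d) (r : Fin d → Fin L),
    ‖((Wcx L (perCfg (towerP L m (j + 1)) (UlevOf L m k U j)) (cornerSite L y) κ (boxVec L r) : 𝔸ˣ) : 𝔸) - 1‖ ≤ α j)
  (α' : ℕ → ℝ) (hα1' : ∀ j, α' j ≤ 1 / 64)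
  (hV1 : ∀ (j : ℕ) (x : B7Prop1Explicit.Site d) (κ : Fin d), perCfg (towerP L m (j + 1)) (UlevOf L m k V j) x κ ∈ U1 𝔸)
  (hregV : ∀ (j : ℕ) (y : TSite d (towerP L m j)) (κ : Fin d) (r : Fin d → Fin L),
    ‖((Wcx L (perCfg (towerP L m (j + 1)) (UlevOf L m k V j)) (cornerSite L y) κ (boxVec L r) : 𝔸ˣ) : 𝔸) - 1‖ ≤ α' j)
  (hα128 : ∀ j, α' j ≤ 1 / 128)
  (εU : ℕ → ℝ) (hεU : ∀ j, 0 ≤ εU j) (hUε : ∀ (j : ℕ) (b : Bond d (towerP L m (j + 1))), ‖(UlevOf L m k U j b : 𝔸) - 1‖ ≤ εU j)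
  (hVε : ∀ (j : ℕ) (b : Bond d (towerP L m (j + 1))), ‖(UlevOf L m k V j b : 𝔸) - 1‖ ≤ εU j)
  (δUV : ℕ → ℝ) (hδUV : ∀ j, 0 ≤ δUV j) (hδmax : ∀ j, δUV j ≤ 1 / (12288 * ((2 * (d * L) + L + L : ℕ) : ℝ)))
  (hUVδ : ∀ (j : ℕ) (b : Bond d (towerP L m (j + 1))), ‖(UlevOf L m k U j b : 𝔸) * (((UlevOf L m k V j b)⁻¹ : 𝔸ˣ) : 𝔸) - 1‖ ≤ δUV j)
  {κc : ℂ} (χ : (j : ℕ) → TSite d (towerP L m j) → ℝ) (ℓ' : ℕ → ℝ) (hℓ' : ∀ j, 0 ≤ ℓ' j)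
  (hχ : ∀ j, j < k → ∀ (c : Bond d (towerP L m j)) (b : Bond d (towerP L m (j + 1))),
    (blockCoord L (towerP L m j) b.1 = c.1 ∨ blockCoord L (towerP L m j) b.1 = shift c.2 c.1) → |χ j c.1 - χ (j + 1) b.1| ≤ ℓ' j)
  (hwin : ∀ j, j < k → ‖κc‖ * ℓ' j ≤ 1)

include hα128 hδUV hδmax hUVδ hℓ' hχ hwin in
/-- **THE BRICK AT LEVEL `j` IN `√` FORM**: `√Σ_c‖e^{κχ_j(c₋)}•(Q(Ū^j)(e^{−κχ_{j+1}}•A))(c) − e^{κχ_j(c₋)}•(Q(V̄^j)(e^{−κχ_{j+1}}•A))(c)‖² ≤ β_j·√Σ_b‖A b‖²`,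
`β_j = (1 + 2‖κ‖ℓ′_j)·2d·75497472(d+1)N·δ_j` (the sibling's brick `sum_norm_sq_QtorusLin_sub_QtorusLin_conj_le` at the level-`j` torus, the outer weight moved
inside by linearity).
[cite: Balaban1985BackgroundPropagators, (3.15) p.393, (3.49) p.399, (3.83) p.407, (3.101) p.414; Balaban1985Averaging, Proposition 7 p.43, (124)–(126) p.36] -/
theorem sqrt_sum_norm_sq_QtorusLin_sub_QtorusLin_conj_le (j : ℕ) (hj : j < k) (A : Bond d (towerP L m (j + 1)) → 𝔸) :
    Real.sqrt (∑ c : Bond d (towerP L m j),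
        ‖Complex.exp (κc * (χ j c.1 : ℂ)) • QtorusLin L (towerP L m j) hL (UlevOf L m k U j) (hα1 j) (hU1 j) (hreg j)
            (fun b => Complex.exp (-(κc * (χ (j + 1) b.1 : ℂ))) • A b) c -
          Complex.exp (κc * (χ j c.1 : ℂ)) • QtorusLin L (towerP L m j) hL (UlevOf L m k V j) (hα1' j) (hV1 j) (hregV j)
            (fun b => Complex.exp (-(κc * (χ (j + 1) b.1 : ℂ))) • A b) c‖ ^ 2) ≤
      ((1 + 2 * (‖κc‖ * ℓ' j)) * (2 * d) * (75497472 * ((d : ℝ) + 1) * ((2 * (d * L) + L + L : ℕ) : ℝ) * δUV j)) *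
        Real.sqrt (∑ b : Bond d (towerP L m (j + 1)), ‖A b‖ ^ 2) := by
  have h := sum_norm_sq_QtorusLin_sub_QtorusLin_conj_le L (towerP L m j) hL (UlevOf L m k U j) (hα1 j) (hU1 j) (hreg j)
    (UlevOf L m k V j) (hα1' j) (hV1 j) (hregV j) (hα128 j) (hδUV j) (hδmax j) (fun b => hUVδ j b) (hℓ' j)
    (κ := κc) (χ := χ (j + 1)) (χ' := χ j) (fun c b hb => hχ j hj c b hb) (hwin j hj) A
  have hβ0 : 0 ≤ (1 + 2 * (‖κc‖ * ℓ' j)) * (2 * d) * (75497472 * ((d : ℝ) + 1) * ((2 * (d * L) + L + L : ℕ) : ℝ) * δUV j) := by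
    have := hℓ' j; have := hδUV j; positivity
  have hre : ∀ c : Bond d (towerP L m j),
      Complex.exp (κc * (χ j c.1 : ℂ)) • QtorusLin L (towerP L m j) hL (UlevOf L m k U j) (hα1 j) (hU1 j) (hreg j)
            (fun b => Complex.exp (-(κc * (χ (j + 1) b.1 : ℂ))) • A b) c -
          Complex.exp (κc * (χ j c.1 : ℂ)) • QtorusLin L (towerP L m j) hL (UlevOf L m k V j) (hα1' j) (hV1 j) (hregV j)
            (fun b => Complex.exp (-(κc * (χ (j + 1) b.1 : ℂ))) • A b) c =
        QtorusLin L (towerP L m j) hL (UlevOf L m k U j) (hα1 j) (hU1 j) (hreg j)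
            (fun b => (Complex.exp (κc * (χ j c.1 : ℂ)) * Complex.exp (-(κc * (χ (j + 1) b.1 : ℂ)))) • A b) c -
          QtorusLin L (towerP L m j) hL (UlevOf L m k V j) (hα1' j) (hV1 j) (hregV j)
            (fun b => (Complex.exp (κc * (χ j c.1 : ℂ)) * Complex.exp (-(κc * (χ (j + 1) b.1 : ℂ)))) • A b) c := fun c => by
    rw [smul_QtorusLin_smul_apply, smul_QtorusLin_smul_apply]
  calc _ = Real.sqrt (∑ c : Bond d (towerP L m j),
          ‖QtorusLin L (towerP L m j) hL (UlevOf L m k U j) (hα1 j) (hU1 j) (hreg j)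
              (fun b => (Complex.exp (κc * (χ j c.1 : ℂ)) * Complex.exp (-(κc * (χ (j + 1) b.1 : ℂ)))) • A b) c -
            QtorusLin L (towerP L m j) hL (UlevOf L m k V j) (hα1' j) (hV1 j) (hregV j)
              (fun b => (Complex.exp (κc * (χ j c.1 : ℂ)) * Complex.exp (-(κc * (χ (j + 1) b.1 : ℂ)))) • A b) c‖ ^ 2) := by
        congr 1; exact Finset.sum_congr rfl fun c _ => by rw [hre c]
    _ ≤ Real.sqrt (((1 + 2 * (‖κc‖ * ℓ' j)) * (2 * d) * (75497472 * ((d : ℝ) + 1) * ((2 * (d * L) + L + L : ℕ) : ℝ) * δUV j)) ^ 2 *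
          ∑ b : Bond d (towerP L m (j + 1)), ‖A b‖ ^ 2) := Real.sqrt_le_sqrt h
    _ = _ := by rw [Real.sqrt_mul' _ (Finset.sum_nonneg fun _ _ => sq_nonneg _), Real.sqrt_sq hβ0]

include hεU hVε hℓ' hχ hwin in
/-- **THE CONJUGATED ONE-FAMILY SIZE**: `√Σ_c‖e^{κχ_0(c₋)}•(Q_n(V)(e^{−κχ_n}•A))(c)‖² ≤ P′_n·(√(L^{−d}))^n·√Σ‖A‖²`, `P′_n = Π_{j<n}(1 + √(L^d)(θ_j + e_j))` —
gen 93's telescoped defect `(P′_n − P_n)` plus leaf-04's one-family size `P_n`, Minkowski.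
[cite: Balaban1985BackgroundPropagators, (3.15)–(3.16) p.393, (3.49) p.399, (3.101)–(3.103) p.414; Balaban1985Averaging, (124)–(127) pp.36–37] -/
theorem sqrt_sum_norm_sq_Qtower_conj_le (n : ℕ) (hn : n ≤ k) (A : Bond d (towerP L m n) → 𝔸) :
    Real.sqrt (∑ c : Bond d m, ‖Complex.exp (κc * (χ 0 c.1 : ℂ)) •
        Qtower L m hL (UlevOf L m k V) α' hα1' hV1 hregV n (fun b => Complex.exp (-(κc * (χ n b.1 : ℂ))) • A b) c‖ ^ 2) ≤
      (∏ j ∈ Finset.range n, (1 + Real.sqrt ((L : ℝ) ^ d) * (Real.sqrt (2 * d) * (102 * (d + 1) ^ 2 * L * εU j) +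
          2 * (‖κc‖ * ℓ' j) * Real.sqrt (2 * (2 * d * (102 * (d + 1) ^ 2 * L * εU j) ^ 2 + ((L : ℝ) ^ d)⁻¹))))) *
        ((Real.sqrt (((L : ℝ) ^ d)⁻¹)) ^ n * Real.sqrt (∑ b : Bond d (towerP L m n), ‖A b‖ ^ 2)) := by
  have hconj := sqrt_sum_norm_sq_Qtower_conj_sub_le L m hL k V α' hα1' hV1 hregV εU hεU hVε χ ℓ' hℓ' hχ hwin n hn A
  have hsize := sqrt_sum_norm_sq_Qtower_le L m hL k V α' hα1' hV1 hregV εU hεU hVε n A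
  have hmink := sqrt_sum_norm_sq_le_add_sub
    (fun c : Bond d m => Complex.exp (κc * (χ 0 c.1 : ℂ)) •
      Qtower L m hL (UlevOf L m k V) α' hα1' hV1 hregV n (fun b => Complex.exp (-(κc * (χ n b.1 : ℂ))) • A b) c)
    (fun c : Bond d m => Qtower L m hL (UlevOf L m k V) α' hα1' hV1 hregV n A c)
  calc _ ≤ _ := hmink
    _ ≤ (∏ j ∈ Finset.range n, (1 + Real.sqrt ((L : ℝ) ^ d) * (Real.sqrt (2 * d) * (102 * (d + 1) ^ 2 * L * εU j)))) *
          ((Real.sqrt (((L : ℝ) ^ d)⁻¹)) ^ n * Real.sqrt (∑ b : Bond d (towerP L m n), ‖A b‖ ^ 2)) +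
        ((∏ j ∈ Finset.range n, (1 + Real.sqrt ((L : ℝ) ^ d) * (Real.sqrt (2 * d) * (102 * (d + 1) ^ 2 * L * εU j) +
            2 * (‖κc‖ * ℓ' j) * Real.sqrt (2 * (2 * d * (102 * (d + 1) ^ 2 * L * εU j) ^ 2 + ((L : ℝ) ^ d)⁻¹))))) -
          ∏ j ∈ Finset.range n, (1 + Real.sqrt ((L : ℝ) ^ d) * (Real.sqrt (2 * d) * (102 * (d + 1) ^ 2 * L * εU j)))) *
          ((Real.sqrt (((L : ℝ) ^ d)⁻¹)) ^ n * Real.sqrt (∑ b : Bond d (towerP L m n), ‖A b‖ ^ 2)) := add_le_add hsize hconj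
    _ = _ := by ring

include hα128 hεU hUε hVε hδUV hδmax hUVδ hℓ' hχ hwin in
/-- **THE COMBES–THOMAS LETTER OF `Q_n(U) − Q_n(V)` IN `ℓ²` (raw, telescoped three-way)**: for every height `n ≤ k` and every `A` on the level-`n` bonds,
`√Σ_c‖e^{κχ_0(c₋)}•(Q_n(U)(e^{−κχ_n}•A))(c) − e^{κχ_0(c₋)}•(Q_n(V)(e^{−κχ_n}•A))(c)‖² ≤ P′_n·(T̃_n − 1)·(√(L^{−d}))^n·√Σ_b‖A b‖²`,
`P′_n = Π_{j<n}(1 + √(L^d)(θ_j + e_j))`, `T̃_n = Π_{j<n}(1 + √(L^d)β_j)` — induction over `Q_{n+1} = Q_n∘Q(·̄^n)` with the intermediate weight `e^{∓κχ_n}`: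
`C^U_{n+1}A − C^V_{n+1}A = (C^U_n − C^V_n)(x′_U) + C^V_n(x′_U − x′_V)`, `‖x′_U‖ ≤ (ρ + θ_n + e_n)‖A‖`, `‖x′_U − x′_V‖ ≤ β_n‖A‖` (the brick), `‖C^V_n‖ ≤ P′_nρ^n`
(`sqrt_sum_norm_sq_Qtower_conj_le`), Minkowski; `D̃_{n+1} ≤ D̃_n(1 + √(L^d)(θ_n + e_n)) + P′_n√(L^d)β_n` closed by `D̃_n ≤ P′_n(T̃_n − 1)`.
[cite: Balaban1985BackgroundPropagators, (3.15)–(3.16) p.393, (3.49) p.399, (3.78)–(3.79) p.406, (3.83) p.407, (3.101)–(3.103) p.414; Balaban1985Averaging, Proposition 7 p.43, (124)–(127) pp.36–37] -/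
theorem sqrt_sum_norm_sq_Qtower_conj_sub_Qtower_conj_le : ∀ (n : ℕ), n ≤ k → ∀ (A : Bond d (towerP L m n) → 𝔸),
    Real.sqrt (∑ c : Bond d m,
        ‖Complex.exp (κc * (χ 0 c.1 : ℂ)) •
            Qtower L m hL (UlevOf L m k U) α hα1 hU1 hreg n (fun b => Complex.exp (-(κc * (χ n b.1 : ℂ))) • A b) c -
          Complex.exp (κc * (χ 0 c.1 : ℂ)) •
            Qtower L m hL (UlevOf L m k V) α' hα1' hV1 hregV n (fun b => Complex.exp (-(κc * (χ n b.1 : ℂ))) • A b) c‖ ^ 2) ≤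
      (∏ j ∈ Finset.range n, (1 + Real.sqrt ((L : ℝ) ^ d) * (Real.sqrt (2 * d) * (102 * (d + 1) ^ 2 * L * εU j) +
          2 * (‖κc‖ * ℓ' j) * Real.sqrt (2 * (2 * d * (102 * (d + 1) ^ 2 * L * εU j) ^ 2 + ((L : ℝ) ^ d)⁻¹))))) *
        ((∏ j ∈ Finset.range n, (1 + Real.sqrt ((L : ℝ) ^ d) *
            ((1 + 2 * (‖κc‖ * ℓ' j)) * (2 * d) * (75497472 * ((d : ℝ) + 1) * ((2 * (d * L) + L + L : ℕ) : ℝ) * δUV j)))) - 1) *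
        ((Real.sqrt (((L : ℝ) ^ d)⁻¹)) ^ n * Real.sqrt (∑ b : Bond d (towerP L m n), ‖A b‖ ^ 2))
  | 0, _, A => by
    have h0 : ∀ c : Bond d m, Complex.exp (κc * (χ 0 c.1 : ℂ)) •
          Qtower L m hL (UlevOf L m k U) α hα1 hU1 hreg 0 (fun b => Complex.exp (-(κc * (χ 0 b.1 : ℂ))) • A b) c -
        Complex.exp (κc * (χ 0 c.1 : ℂ)) •
          Qtower L m hL (UlevOf L m k V) α' hα1' hV1 hregV 0 (fun b => Complex.exp (-(κc * (χ 0 b.1 : ℂ))) • A b) c = 0 := fun c => by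
      show Complex.exp (κc * (χ 0 c.1 : ℂ)) • (Complex.exp (-(κc * (χ 0 c.1 : ℂ))) • A c) -
          Complex.exp (κc * (χ 0 c.1 : ℂ)) • (Complex.exp (-(κc * (χ 0 c.1 : ℂ))) • A c) = 0
      exact sub_self _
    have hsum : ∑ c : Bond d m, ‖Complex.exp (κc * (χ 0 c.1 : ℂ)) •
          Qtower L m hL (UlevOf L m k U) α hα1 hU1 hreg 0 (fun b => Complex.exp (-(κc * (χ 0 b.1 : ℂ))) • A b) c -
        Complex.exp (κc * (χ 0 c.1 : ℂ)) •
          Qtower L m hL (UlevOf L m k V) α' hα1' hV1 hregV 0 (fun b => Complex.exp (-(κc * (χ 0 b.1 : ℂ))) • A b) c‖ ^ 2 = 0 :=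
      Finset.sum_eq_zero fun c _ => by rw [h0 c, norm_zero, zero_pow two_ne_zero]
    rw [hsum, Real.sqrt_zero, Finset.prod_range_zero, Finset.prod_range_zero, sub_self, mul_zero, zero_mul]
  | n + 1, hn, A => by
    have hL0 : (0 : ℝ) < L := by exact_mod_cast hL
    have hnk : n < k := hn
    -- shorthands
    set θ : ℕ → ℝ := fun j => Real.sqrt (2 * d) * (102 * (d + 1) ^ 2 * L * εU j) with hθ
    have hθ0 : ∀ j, 0 ≤ θ j := fun j => by rw [hθ]; have := hεU j; positivity
    set e : ℕ → ℝ := fun j => 2 * (‖κc‖ * ℓ' j) * Real.sqrt (2 * (2 * d * (102 * (d + 1) ^ 2 * L * εU j) ^ 2 + ((L : ℝ) ^ d)⁻¹)) with he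
    have he0 : ∀ j, 0 ≤ e j := fun j => by rw [he]; have := hℓ' j; positivity
    set β : ℕ → ℝ := fun j => (1 + 2 * (‖κc‖ * ℓ' j)) * (2 * d) * (75497472 * ((d : ℝ) + 1) * ((2 * (d * L) + L + L : ℕ) : ℝ) * δUV j)
      with hβ
    have hβ0 : ∀ j, 0 ≤ β j := fun j => by rw [hβ]; have := hℓ' j; have := hδUV j; positivity
    set σ : ℝ := Real.sqrt ((L : ℝ) ^ d) with hσ
    have hσ0 : 0 ≤ σ := Real.sqrt_nonneg _
    set ρ : ℝ := Real.sqrt (((L : ℝ) ^ d)⁻¹) with hρ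
    have hρ0 : 0 ≤ ρ := Real.sqrt_nonneg _
    have hρL : σ * ρ = 1 := by
      rw [hρ, hσ, ← Real.sqrt_mul (by positivity), mul_inv_cancel₀ (by positivity), Real.sqrt_one]
    set P : ℝ := ∏ j ∈ Finset.range n, (1 + σ * (θ j + e j)) with hP
    set T : ℝ := ∏ j ∈ Finset.range n, (1 + σ * β j) with hT
    have hP1 : 1 ≤ P := Finset.one_le_prod (s := Finset.range n) fun j _ => by nlinarith [hθ0 j, he0 j, hσ0]
    have hT1 : 1 ≤ T := Finset.one_le_prod (s := Finset.range n) fun j _ => by nlinarith [hβ0 j, hσ0]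
    -- the tower maps and the conjugated one-step images at level `n`
    set QU := Qtower L m hL (UlevOf L m k U) α hα1 hU1 hreg with hQU
    set QV := Qtower L m hL (UlevOf L m k V) α' hα1' hV1 hregV with hQV
    set xU : Bond d (towerP L m n) → 𝔸 := QtorusLin L (towerP L m n) hL (UlevOf L m k U n) (hα1 n) (hU1 n) (hreg n) A with hxU
    set x'U : Bond d (towerP L m n) → 𝔸 := fun c => Complex.exp (κc * (χ n c.1 : ℂ)) •
      QtorusLin L (towerP L m n) hL (UlevOf L m k U n) (hα1 n) (hU1 n) (hreg n) (fun b => Complex.exp (-(κc * (χ (n + 1) b.1 : ℂ))) • A b) c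
      with hx'U
    set x'V : Bond d (towerP L m n) → 𝔸 := fun c => Complex.exp (κc * (χ n c.1 : ℂ)) •
      QtorusLin L (towerP L m n) hL (UlevOf L m k V n) (hα1' n) (hV1 n) (hregV n) (fun b => Complex.exp (-(κc * (χ (n + 1) b.1 : ℂ))) • A b) c
      with hx'V
    set S : ℝ := Real.sqrt (∑ b, ‖A b‖ ^ 2) with hS
    have hS0 : 0 ≤ S := Real.sqrt_nonneg _
    -- (a) the size of `x′_U`: flat + deviation + gen 93's brick
    have hE : ∀ c, x'U c - xU c = QtorusLin L (towerP L m n) hL (UlevOf L m k U n) (hα1 n) (hU1 n) (hreg n)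
        (fun b => (Complex.exp (κc * (χ n c.1 : ℂ)) * Complex.exp (-(κc * (χ (n + 1) b.1 : ℂ))) - 1) • A b) c := fun c =>
      conj_QtorusLin_sub_apply L hL _ (hα1 n) (hU1 n) (hreg n) _ _ A c
    have hNE : Real.sqrt (∑ c, ‖x'U c - xU c‖ ^ 2) ≤ e n * S := by
      have h := sqrt_sum_norm_sq_QtorusLin_conj_le L m hL k U α hα1 hU1 hreg εU hεU hUε χ ℓ' hℓ' hχ hwin n hnk A
      exact le_of_eq_of_le (congrArg Real.sqrt (Finset.sum_congr rfl fun c _ => by rw [hE c])) h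
    have hNx : Real.sqrt (∑ c, ‖xU c‖ ^ 2) ≤ (ρ + θ n) * S := by
      set y : Bond d (towerP L m n) → 𝔸 := QtorusLin L (towerP L m n) hL (fun _ : Bond d (fineP L (towerP L m n)) => (1 : 𝔸ˣ))
        (show (0 : ℝ) ≤ 1 / 64 by norm_num) (B5Eq172FlatCoercivity.hU1_one L (towerP L m n)) (B5Eq172FlatCoercivity.hreg_one L (towerP L m n)) A
        with hy
      have hflat : Real.sqrt (∑ b, ‖y b‖ ^ 2) ≤ ρ * S := by
        have h := sum_norm_sq_QtorusLin_one_le L (towerP L m n) hL (show (0 : ℝ) ≤ 1 / 64 by norm_num)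
          (B5Eq172FlatCoercivity.hU1_one L (towerP L m n)) (B5Eq172FlatCoercivity.hreg_one L (towerP L m n)) A
        calc Real.sqrt (∑ b, ‖y b‖ ^ 2) ≤ Real.sqrt (((L : ℝ) ^ d)⁻¹ * ∑ b, ‖A b‖ ^ 2) := Real.sqrt_le_sqrt h
          _ = ρ * S := Real.sqrt_mul (by positivity) _
      have hdev : Real.sqrt (∑ b, ‖xU b - y b‖ ^ 2) ≤ θ n * S := by
        have h := sum_norm_sq_QtorusLin_sub_flat_le L (towerP L m n) hL (UlevOf L m k U n) (hα1 n) (hU1 n) (hreg n)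
          (show (0 : ℝ) ≤ 1 / 64 by norm_num) (B5Eq172FlatCoercivity.hU1_one L (towerP L m n)) (B5Eq172FlatCoercivity.hreg_one L (towerP L m n))
          (hεU n) (fun b => hUε n b) A
        calc Real.sqrt (∑ b, ‖xU b - y b‖ ^ 2) ≤ Real.sqrt (2 * d * (102 * (d + 1) ^ 2 * L * εU n) ^ 2 * ∑ b, ‖A b‖ ^ 2) := Real.sqrt_le_sqrt h
          _ = Real.sqrt ((θ n) ^ 2 * ∑ b, ‖A b‖ ^ 2) := by
              congr 1; rw [hθ]; simp only [mul_pow, Real.sq_sqrt (by positivity : (0 : ℝ) ≤ 2 * d)]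
          _ = θ n * S := by rw [Real.sqrt_mul' _ (by positivity), Real.sqrt_sq (hθ0 n)]
      have h := sqrt_sum_norm_sq_le_add_sub xU y
      nlinarith [hflat, hdev]
    have hNx' : Real.sqrt (∑ c, ‖x'U c‖ ^ 2) ≤ (ρ + θ n + e n) * S := by
      have h := sqrt_sum_norm_sq_le_add_sub x'U xU
      nlinarith [hNx, hNE]
    -- (b) the brick at level `n`: `‖x′_U − x′_V‖ ≤ β_n‖A‖`
    have hz : Real.sqrt (∑ c, ‖x'U c - x'V c‖ ^ 2) ≤ β n * S :=
      sqrt_sum_norm_sq_QtorusLin_sub_QtorusLin_conj_le L m hL k U V α hα1 hU1 hreg α' hα1' hV1 hregV hα128 δUV hδUV hδmax hUVδ χ ℓ' hℓ' hχ hwin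
        n hnk A
    -- (c) the induction hypothesis at `x′_U` and the conjugated size of `Q_n(V)` at `x′_U − x′_V`
    have ih := sqrt_sum_norm_sq_Qtower_conj_sub_Qtower_conj_le n (Nat.le_of_succ_le hn) x'U
    have hCV := sqrt_sum_norm_sq_Qtower_conj_le L m hL k V α' hα1' hV1 hregV εU hεU hVε χ ℓ' hℓ' hχ hwin n (Nat.le_of_succ_le hn)
      (fun c => x'U c - x'V c)
    -- (d) the split `C^U_{n+1}A − C^V_{n+1}A = (C^U_n − C^V_n)(x′_U) + C^V_n(x′_U − x′_V)`
    have hsplit : ∀ c : Bond d m,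
        Complex.exp (κc * (χ 0 c.1 : ℂ)) • QU (n + 1) (fun b => Complex.exp (-(κc * (χ (n + 1) b.1 : ℂ))) • A b) c -
          Complex.exp (κc * (χ 0 c.1 : ℂ)) • QV (n + 1) (fun b => Complex.exp (-(κc * (χ (n + 1) b.1 : ℂ))) • A b) c =
        (Complex.exp (κc * (χ 0 c.1 : ℂ)) • QU n (fun b => Complex.exp (-(κc * (χ n b.1 : ℂ))) • x'U b) c -
            Complex.exp (κc * (χ 0 c.1 : ℂ)) • QV n (fun b => Complex.exp (-(κc * (χ n b.1 : ℂ))) • x'U b) c) +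
          Complex.exp (κc * (χ 0 c.1 : ℂ)) • QV n (fun b => Complex.exp (-(κc * (χ n b.1 : ℂ))) • (x'U b - x'V b)) c := by
      intro c
      have e1 : QU (n + 1) (fun b => Complex.exp (-(κc * (χ (n + 1) b.1 : ℂ))) • A b) c =
          QU n (QtorusLin L (towerP L m n) hL (UlevOf L m k U n) (hα1 n) (hU1 n) (hreg n)
            (fun b => Complex.exp (-(κc * (χ (n + 1) b.1 : ℂ))) • A b)) c := rfl
      have e2 : QV (n + 1) (fun b => Complex.exp (-(κc * (χ (n + 1) b.1 : ℂ))) • A b) c =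
          QV n (QtorusLin L (towerP L m n) hL (UlevOf L m k V n) (hα1' n) (hV1 n) (hregV n)
            (fun b => Complex.exp (-(κc * (χ (n + 1) b.1 : ℂ))) • A b)) c := rfl
      have e3 : QtorusLin L (towerP L m n) hL (UlevOf L m k U n) (hα1 n) (hU1 n) (hreg n)
          (fun b => Complex.exp (-(κc * (χ (n + 1) b.1 : ℂ))) • A b) = fun b => Complex.exp (-(κc * (χ n b.1 : ℂ))) • x'U b := by
        funext b
        rw [hx'U]; dsimp only
        rw [smul_smul, ← Complex.exp_add, neg_add_cancel, Complex.exp_zero, one_smul]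
      have e4 : QtorusLin L (towerP L m n) hL (UlevOf L m k V n) (hα1' n) (hV1 n) (hregV n)
          (fun b => Complex.exp (-(κc * (χ (n + 1) b.1 : ℂ))) • A b) = fun b => Complex.exp (-(κc * (χ n b.1 : ℂ))) • x'V b := by
        funext b
        rw [hx'V]; dsimp only
        rw [smul_smul, ← Complex.exp_add, neg_add_cancel, Complex.exp_zero, one_smul]
      have e5 : (fun b => Complex.exp (-(κc * (χ n b.1 : ℂ))) • (x'U b - x'V b)) =
          (fun b => Complex.exp (-(κc * (χ n b.1 : ℂ))) • x'U b) - (fun b => Complex.exp (-(κc * (χ n b.1 : ℂ))) • x'V b) := by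
        funext b; simp only [Pi.sub_apply, smul_sub]
      rw [e1, e2, e3, e4, e5, map_sub, Pi.sub_apply, smul_sub]
      abel
    have key : σ * β n ≤ (1 + σ * (θ n + e n)) * T * (σ * β n) := by
      have h1 : 1 ≤ (1 + σ * (θ n + e n)) * T :=
        calc (1 : ℝ) ≤ T := hT1
          _ ≤ (1 + σ * (θ n + e n)) * T :=
              le_mul_of_one_le_left (zero_le_one.trans hT1) (by nlinarith [mul_nonneg hσ0 (add_nonneg (hθ0 n) (he0 n))])
      have h2 : 0 ≤ σ * β n := mul_nonneg hσ0 (hβ0 n)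
      calc σ * β n = 1 * (σ * β n) := (one_mul _).symm
        _ ≤ (1 + σ * (θ n + e n)) * T * (σ * β n) := mul_le_mul_of_nonneg_right h1 h2
    have hPr : 0 ≤ P := zero_le_one.trans hP1
    have hPT : 0 ≤ P * (T - 1) := mul_nonneg hPr (sub_nonneg.2 hT1)
    calc Real.sqrt (∑ c : Bond d m,
          ‖Complex.exp (κc * (χ 0 c.1 : ℂ)) • QU (n + 1) (fun b => Complex.exp (-(κc * (χ (n + 1) b.1 : ℂ))) • A b) c -
            Complex.exp (κc * (χ 0 c.1 : ℂ)) • QV (n + 1) (fun b => Complex.exp (-(κc * (χ (n + 1) b.1 : ℂ))) • A b) c‖ ^ 2)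
        = Real.sqrt (∑ c : Bond d m,
            ‖(Complex.exp (κc * (χ 0 c.1 : ℂ)) • QU n (fun b => Complex.exp (-(κc * (χ n b.1 : ℂ))) • x'U b) c -
                Complex.exp (κc * (χ 0 c.1 : ℂ)) • QV n (fun b => Complex.exp (-(κc * (χ n b.1 : ℂ))) • x'U b) c) +
              Complex.exp (κc * (χ 0 c.1 : ℂ)) • QV n (fun b => Complex.exp (-(κc * (χ n b.1 : ℂ))) • (x'U b - x'V b)) c‖ ^ 2) := by
          congr 1; exact Finset.sum_congr rfl fun c _ => by rw [hsplit c]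
      _ ≤ Real.sqrt (∑ c : Bond d m,
            ‖Complex.exp (κc * (χ 0 c.1 : ℂ)) • QU n (fun b => Complex.exp (-(κc * (χ n b.1 : ℂ))) • x'U b) c -
                Complex.exp (κc * (χ 0 c.1 : ℂ)) • QV n (fun b => Complex.exp (-(κc * (χ n b.1 : ℂ))) • x'U b) c‖ ^ 2) +
          Real.sqrt (∑ c : Bond d m,
            ‖Complex.exp (κc * (χ 0 c.1 : ℂ)) • QV n (fun b => Complex.exp (-(κc * (χ n b.1 : ℂ))) • (x'U b - x'V b)) c‖ ^ 2) :=
          sqrt_sum_norm_add_sq_le _ _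
      _ ≤ P * (T - 1) * (ρ ^ n * Real.sqrt (∑ b, ‖x'U b‖ ^ 2)) + P * (ρ ^ n * Real.sqrt (∑ b, ‖x'U b - x'V b‖ ^ 2)) := add_le_add ih hCV
      _ ≤ P * (T - 1) * (ρ ^ n * ((ρ + θ n + e n) * S)) + P * (ρ ^ n * (β n * S)) :=
          add_le_add (mul_le_mul_of_nonneg_left (mul_le_mul_of_nonneg_left hNx' (pow_nonneg hρ0 n)) hPT)
            (mul_le_mul_of_nonneg_left (mul_le_mul_of_nonneg_left hz (pow_nonneg hρ0 n)) hPr)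
      _ = P * ((T - 1) * (1 + σ * (θ n + e n)) + σ * β n) * (ρ ^ (n + 1) * S) := by
          rw [pow_succ]
          linear_combination (-(P * (T - 1) * ρ ^ n * (θ n + e n) * S + P * ρ ^ n * β n * S)) * hρL
      _ ≤ P * ((1 + σ * (θ n + e n)) * (T * (1 + σ * β n) - 1)) * (ρ ^ (n + 1) * S) := by
          have hρS : 0 ≤ ρ ^ (n + 1) * S := by positivity
          have eq : (1 + σ * (θ n + e n)) * (T * (1 + σ * β n) - 1) - ((T - 1) * (1 + σ * (θ n + e n)) + σ * β n) =
              (1 + σ * (θ n + e n)) * T * (σ * β n) - σ * β n := by ring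
          have hmid : (T - 1) * (1 + σ * (θ n + e n)) + σ * β n ≤ (1 + σ * (θ n + e n)) * (T * (1 + σ * β n) - 1) := by
            linarith [key, eq]
          exact mul_le_mul_of_nonneg_right (mul_le_mul_of_nonneg_left hmid hPr) hρS
      _ = ((∏ j ∈ Finset.range (n + 1), (1 + σ * (θ j + e j))) * ((∏ j ∈ Finset.range (n + 1), (1 + σ * β j)) - 1)) *
            (ρ ^ (n + 1) * S) := by
          rw [Finset.prod_range_succ, Finset.prod_range_succ, hP, hT]; ring

end Tower

end Literature.MathematicalPhysics.QuantumFieldTheory.Balaban1983to89.B9Eq349ConjugatedQTowerLettersTwoBackgrounds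

end
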